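import Summits.BirchSwinnertonDyer.BirchSwinnertonDyer.Theorems.ManinLocalTwoThreeEulerRemaindersFortyEight
import Summits.BirchSwinnertonDyer.BirchSwinnertonDyer.Theorems.ManinLocalTwoThreeEulerRemaindersSixtyFour
import HarnessLib

/-!
# The Euler functions at level 40: `E₁`, `E₅` modulo `o(q⁹)`; `y`, `g₁`, `g₂` as `q`-monomials times Euler functions;
# the derivative of `y`

Cell bsd-f2-manin, route `ManinLocalTwoThree` (crux C2 `ManinOddAtFour`, stmt-22967: `2² ∣ 40`), prover seat p2 gen 27; the
level-`40` analogue of `EulerRemaindersFortyEight` — toolkit for the newform pinning and the three limits (T1)₄₀–(T3)₄₀ of the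
`X₀(40) → 40a1` programme (`40 = 2³·5`, genus `g(X₀(40)) = 3`).  With `E_δ(τ) = ∏_{n ≥ 1} (1 − q^{δn})` (`eulerFn δ`),
`q = e^{2πiτ}`, in the remainder language of `ManinLocalTwoThreeQRemainderCalculus`:

* `E₁ = 1 − q − q² + q⁵ + q⁷ + o(q⁹)` (Euler's pentagonal numbers `1, 2, 5, 7, 12, …`), `E₅ = 1 − q⁵ + o(q⁹)`;
* the level-`40` objects supported on the divisors of `20`:
  `y = η(4τ)²η(10τ)⁴/η(20τ)⁶ = E₄²E₁₀⁴/(q³E₂₀⁶)` (the `y`-coordinate of `X₀(40) → 40a1`),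
  `g₁ = η(2τ)⁵η(5τ)²η(20τ)/(η(τ)²η(4τ)η(10τ)) = qE₂⁵E₅²E₂₀/(E₁²E₄E₁₀)`, `g₂ = η(4τ)²η(20τ)² = q²E₄²E₂₀²`
  (the newform of level `40` is `φ₄₀ = g₁ − 2g₂`, `…NewformForty`);
* the logarithmic derivative `deriv_y40`.

The `x`-coordinate is the level-`20` function `x = η₄η₁₀⁵/(η₂η₂₀⁵)` of the tree (`EulerRemaindersTwenty.x20_eq`, `deriv_x20`).
No definition, no named fact, no sorry; nothing here proves C2, Manin's conjecture or BSD. [folklore] -/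

set_option autoImplicit false
-- lint-debt: the directory name repeats the summit name (sibling precedent `ManinLocalTwoThreeEulerRemaindersFortyEight.lean`)
set_option linter.dupNamespace false

noncomputable section

open Complex Filter Topology Set Asymptotics Polynomial
open UpperHalfPlane hiding I
open scoped Real Topology Manifold MatrixGroups
open Literature.NumberTheory.EllipticCurves Literature.NumberTheory.EllipticCurves.ModularForms

namespace Summit.BirchSwinnertonDyer.BirchSwinnertonDyer.Theorems.ManinLocalTwoThree.EulerRemaindersForty

open QRemainder EulerRemainders
open LigozatIdentities (hasDerivAt_eulerFn_comp)
open EulerRemaindersSixtyFour (cexp_eq_qParam_pow)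

/-! ## §1 `E₁` and `E₅` modulo `o(q⁹)` -/

/-- `∏_{n ≥ 1} (1 − Xⁿ) = 1 − X − X² + X⁵ + X⁷ − X¹² − ⋯` (Euler's pentagonal number theorem): the coefficients `0, …, 9`.
[folklore] -/
theorem coeff_formalEulerPow_one_le_nine (n : ℕ) (hn : n ≤ 9) :
    PowerSeries.coeff n (formalEulerPow 1)
      = if n = 0 then 1 else if n = 1 then -1 else if n = 2 then -1 else if n = 5 then 1 else if n = 7 then 1 else 0 := by
  have h9 : eulerTrunc 1 9 = 1 - PowerSeries.X - PowerSeries.X ^ 2 + PowerSeries.X ^ 5 + PowerSeries.X ^ 7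
      + PowerSeries.X ^ 10 - 2 * PowerSeries.X ^ 12 - PowerSeries.X ^ 13 - PowerSeries.X ^ 14 - PowerSeries.X ^ 15
      + PowerSeries.X ^ 17 + PowerSeries.X ^ 18 + PowerSeries.X ^ 19 + 2 * PowerSeries.X ^ 20 + PowerSeries.X ^ 21
      + PowerSeries.X ^ 22 - PowerSeries.X ^ 23 - PowerSeries.X ^ 24 - 2 * PowerSeries.X ^ 25 - PowerSeries.X ^ 26
      - PowerSeries.X ^ 27 - PowerSeries.X ^ 28 + PowerSeries.X ^ 30 + PowerSeries.X ^ 31 + PowerSeries.X ^ 32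
      + 2 * PowerSeries.X ^ 33 - PowerSeries.X ^ 35 - PowerSeries.X ^ 38 - PowerSeries.X ^ 40 + PowerSeries.X ^ 43
      + PowerSeries.X ^ 44 - PowerSeries.X ^ 45 := by
    rw [eulerTrunc]
    simp only [Finset.prod_range_succ, Finset.prod_range_zero]
    ring
  rw [coeff_formalEulerPow hn, h9]
  interval_cases n <;> simp [PowerSeries.coeff_X_pow, PowerSeries.coeff_X, PowerSeries.coeff_mul_X_pow']

/-- The first ten `q`-coefficients of `E₁`: `1, −1, −1, 0, 0, 1, 0, 1, 0, 0`. [folklore] -/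
theorem coeff_formalEulerScaled_one_le_nine (n : ℕ) (hn : n ≤ 9) :
    PowerSeries.coeff n (formalEulerScaled 1)
      = if n = 0 then 1 else if n = 1 then -1 else if n = 2 then -1 else if n = 5 then 1 else if n = 7 then 1 else 0 := by
  rw [coeff_formalEulerScaled, if_pos (one_dvd n), Nat.div_one, coeff_formalEulerPow_one_le_nine n hn]

/-- **`E₁ = 1 − q − q² + q⁵ + q⁷ + o(q⁹)`.** [folklore] -/
theorem tendsto_eulerFn_one_nine :
    Tendsto (fun τ : ℍ ↦ (eulerFn 1 τ - (1 - X - X ^ 2 + X ^ 5 + X ^ 7 : ℂ[X]).eval (Function.Periodic.qParam 1 (τ : ℂ)))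
      / Function.Periodic.qParam 1 (τ : ℂ) ^ 9) atImInfty (𝓝 0) := by
  refine congr_poly ?_ (tendsto_of_hasSum (periodic_eulerFn 1) (mdifferentiable_eulerFn 1)
    (isBoundedAtImInfty_eulerFn (by norm_num)) (hasSum_eulerFn (by norm_num)) 9)
  have h := coeff_formalEulerScaled_one_le_nine
  simp only [Finset.sum_range_succ, Finset.sum_range_zero, h 0 (by norm_num), h 1 (by norm_num),
    h 2 (by norm_num), h 3 (by norm_num), h 4 (by norm_num), h 5 (by norm_num), h 6 (by norm_num),
    h 7 (by norm_num), h 8 (by norm_num), h 9 (by norm_num)]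
  norm_num
  ring

/-- The first ten `q`-coefficients of `E₅`: `1, 0, 0, 0, 0, −1, 0, 0, 0, 0`. [folklore] -/
theorem coeff_formalEulerScaled_five_le_nine (n : ℕ) (hn : n ≤ 9) :
    PowerSeries.coeff n (formalEulerScaled 5) = if n = 0 then 1 else if n = 5 then -1 else 0 := by
  have h0 := EulerRemaindersTwenty.coeff_formalEulerPow_one_le_six 0 (by norm_num)
  have h1 := EulerRemaindersTwenty.coeff_formalEulerPow_one_le_six 1 (by norm_num)
  simp only at h0 h1
  interval_cases n <;> simp +decide [coeff_formalEulerScaled, h0, h1]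

/-- **`E₅ = 1 − q⁵ + o(q⁹)`.** [folklore] -/
theorem tendsto_eulerFn_five_nine :
    Tendsto (fun τ : ℍ ↦ (eulerFn 5 τ - (1 - X ^ 5 : ℂ[X]).eval (Function.Periodic.qParam 1 (τ : ℂ)))
      / Function.Periodic.qParam 1 (τ : ℂ) ^ 9) atImInfty (𝓝 0) := by
  refine congr_poly ?_ (tendsto_of_hasSum (periodic_eulerFn 5) (mdifferentiable_eulerFn 5)
    (isBoundedAtImInfty_eulerFn (by norm_num)) (hasSum_eulerFn (by norm_num)) 9)
  have h := coeff_formalEulerScaled_five_le_nine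
  simp only [Finset.sum_range_succ, Finset.sum_range_zero, h 0 (by norm_num), h 1 (by norm_num),
    h 2 (by norm_num), h 3 (by norm_num), h 4 (by norm_num), h 5 (by norm_num), h 6 (by norm_num),
    h 7 (by norm_num), h 8 (by norm_num), h 9 (by norm_num)]
  norm_num
  ring

/-! ## §2 `y`, `g₁`, `g₂` in terms of `q` and the Euler functions -/

/-- **`y = η₄²η₁₀⁴/η₂₀⁶ = E₄²E₁₀⁴/(q³ E₂₀⁶)`** (as an `η`-quotient of level `40`). [folklore] -/
theorem y40_eq (τ : ℍ) :
    etaQuotient 40 (expFn [(4, 2), (10, 4), (20, -6)]) τ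
      = eulerFn 4 τ ^ 2 * eulerFn 10 τ ^ 4 / (Function.Periodic.qParam 1 (τ : ℂ) ^ 3 * eulerFn 20 τ ^ 6) := by
  have hE20 := eulerFn_ne_zero (by norm_num : 0 < 20) τ
  have hq := qParam_ne_zero τ
  rw [etaQuotient_eq_cexp_mul_prod, show Nat.divisors 40 = {1, 2, 4, 5, 8, 10, 20, 40} by decide]
  have hsum : (∑ δ ∈ ({1, 2, 4, 5, 8, 10, 20, 40} : Finset ℕ),
      (δ : ℤ) * expFn [(4, 2), (10, 4), (20, -6)] δ) = (-(24 * 3 : ℕ) : ℤ) := by decide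
  rw [hsum, cexp_neg_eq_inv_qParam_pow]
  rw [Finset.prod_insert (by decide), Finset.prod_insert (by decide), Finset.prod_insert (by decide),
    Finset.prod_insert (by decide), Finset.prod_insert (by decide), Finset.prod_insert (by decide),
    Finset.prod_insert (by decide), Finset.prod_singleton]
  rw [show expFn [(4, 2), (10, 4), (20, -6)] 1 = 0 by decide,
    show expFn [(4, 2), (10, 4), (20, -6)] 2 = 0 by decide,
    show expFn [(4, 2), (10, 4), (20, -6)] 4 = 2 by decide,
    show expFn [(4, 2), (10, 4), (20, -6)] 5 = 0 by decide,
    show expFn [(4, 2), (10, 4), (20, -6)] 8 = 0 by decide,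
    show expFn [(4, 2), (10, 4), (20, -6)] 10 = 4 by decide,
    show expFn [(4, 2), (10, 4), (20, -6)] 20 = (-6) by decide,
    show expFn [(4, 2), (10, 4), (20, -6)] 40 = 0 by decide]
  simp only [zpow_neg, zpow_ofNat]
  field_simp

/-- **`g₁ = η₂⁵η₅²η₂₀/(η₁²η₄η₁₀) = q E₂⁵E₅²E₂₀/(E₁²E₄E₁₀)`** (as an `η`-quotient of level `40`). [folklore] -/
theorem g1_eq (τ : ℍ) :
    etaQuotient 40 (expFn [(1, -2), (2, 5), (4, -1), (5, 2), (10, -1), (20, 1)]) τ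
      = Function.Periodic.qParam 1 (τ : ℂ) * eulerFn 2 τ ^ 5 * eulerFn 5 τ ^ 2 * eulerFn 20 τ
        / (eulerFn 1 τ ^ 2 * eulerFn 4 τ * eulerFn 10 τ) := by
  have hE1 := eulerFn_ne_zero (by norm_num : 0 < 1) τ
  have hE4 := eulerFn_ne_zero (by norm_num : 0 < 4) τ
  have hE10 := eulerFn_ne_zero (by norm_num : 0 < 10) τ
  have hq := qParam_ne_zero τ
  rw [etaQuotient_eq_cexp_mul_prod, show Nat.divisors 40 = {1, 2, 4, 5, 8, 10, 20, 40} by decide]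
  have hsum : (∑ δ ∈ ({1, 2, 4, 5, 8, 10, 20, 40} : Finset ℕ),
      (δ : ℤ) * expFn [(1, -2), (2, 5), (4, -1), (5, 2), (10, -1), (20, 1)] δ) = ((24 * 1 : ℕ) : ℤ) := by decide
  rw [hsum, cexp_eq_qParam_pow, pow_one]
  rw [Finset.prod_insert (by decide), Finset.prod_insert (by decide), Finset.prod_insert (by decide),
    Finset.prod_insert (by decide), Finset.prod_insert (by decide), Finset.prod_insert (by decide),
    Finset.prod_insert (by decide), Finset.prod_singleton]
  rw [show expFn [(1, -2), (2, 5), (4, -1), (5, 2), (10, -1), (20, 1)] 1 = (-2) by decide,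
    show expFn [(1, -2), (2, 5), (4, -1), (5, 2), (10, -1), (20, 1)] 2 = 5 by decide,
    show expFn [(1, -2), (2, 5), (4, -1), (5, 2), (10, -1), (20, 1)] 4 = (-1) by decide,
    show expFn [(1, -2), (2, 5), (4, -1), (5, 2), (10, -1), (20, 1)] 5 = 2 by decide,
    show expFn [(1, -2), (2, 5), (4, -1), (5, 2), (10, -1), (20, 1)] 8 = 0 by decide,
    show expFn [(1, -2), (2, 5), (4, -1), (5, 2), (10, -1), (20, 1)] 10 = (-1) by decide,
    show expFn [(1, -2), (2, 5), (4, -1), (5, 2), (10, -1), (20, 1)] 20 = 1 by decide,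
    show expFn [(1, -2), (2, 5), (4, -1), (5, 2), (10, -1), (20, 1)] 40 = 0 by decide]
  simp only [zpow_neg, zpow_ofNat]
  field_simp

/-- **`g₂ = η₄²η₂₀² = q² E₄²E₂₀²`** (as an `η`-quotient of level `40`; `= f₂₀(2τ)`). [folklore] -/
theorem g2_eq (τ : ℍ) :
    etaQuotient 40 (expFn [(4, 2), (20, 2)]) τ
      = Function.Periodic.qParam 1 (τ : ℂ) ^ 2 * eulerFn 4 τ ^ 2 * eulerFn 20 τ ^ 2 := by
  rw [etaQuotient_eq_cexp_mul_prod, show Nat.divisors 40 = {1, 2, 4, 5, 8, 10, 20, 40} by decide]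
  have hsum : (∑ δ ∈ ({1, 2, 4, 5, 8, 10, 20, 40} : Finset ℕ),
      (δ : ℤ) * expFn [(4, 2), (20, 2)] δ) = ((24 * 2 : ℕ) : ℤ) := by decide
  rw [hsum, cexp_eq_qParam_pow]
  rw [Finset.prod_insert (by decide), Finset.prod_insert (by decide), Finset.prod_insert (by decide),
    Finset.prod_insert (by decide), Finset.prod_insert (by decide), Finset.prod_insert (by decide),
    Finset.prod_insert (by decide), Finset.prod_singleton]
  rw [show expFn [(4, 2), (20, 2)] 1 = 0 by decide,
    show expFn [(4, 2), (20, 2)] 2 = 0 by decide,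
    show expFn [(4, 2), (20, 2)] 4 = 2 by decide,
    show expFn [(4, 2), (20, 2)] 5 = 0 by decide,
    show expFn [(4, 2), (20, 2)] 8 = 0 by decide,
    show expFn [(4, 2), (20, 2)] 10 = 0 by decide,
    show expFn [(4, 2), (20, 2)] 20 = 2 by decide,
    show expFn [(4, 2), (20, 2)] 40 = 0 by decide]
  simp only [zpow_ofNat]
  ring

/-! ## §3 The derivative of `y` -/

/-- **`y′ = y · (2E₄′/E₄ + 4E₁₀′/E₁₀ − 3·2πi − 6E₂₀′/E₂₀)`.** [folklore] -/
theorem deriv_y40 (τ : ℍ) :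
    deriv (etaQuotient 40 (expFn [(4, 2), (10, 4), (20, -6)]) ∘ ofComplex) τ
      = eulerFn 4 τ ^ 2 * eulerFn 10 τ ^ 4 / (Function.Periodic.qParam 1 (τ : ℂ) ^ 3 * eulerFn 20 τ ^ 6)
        * (2 * deriv (eulerFn 4 ∘ ofComplex) τ / eulerFn 4 τ
          + 4 * deriv (eulerFn 10 ∘ ofComplex) τ / eulerFn 10 τ - 3 * (2 * π * I)
          - 6 * deriv (eulerFn 20 ∘ ofComplex) τ / eulerFn 20 τ) := by
  have hE4 := eulerFn_ne_zero (by norm_num : 0 < 4) τ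
  have hE10 := eulerFn_ne_zero (by norm_num : 0 < 10) τ
  have hE20 := eulerFn_ne_zero (by norm_num : 0 < 20) τ
  have hq := qParam_ne_zero τ
  have hfun : (etaQuotient 40 (expFn [(4, 2), (10, 4), (20, -6)]) ∘ ofComplex) =ᶠ[𝓝 (τ : ℂ)]
      fun z ↦ (eulerFn 4 ∘ ofComplex) z ^ 2 * (eulerFn 10 ∘ ofComplex) z ^ 4
        / (Function.Periodic.qParam 1 z ^ 3 * (eulerFn 20 ∘ ofComplex) z ^ 6) := by
    filter_upwards [isOpen_upperHalfPlaneSet.mem_nhds τ.im_pos] with z hz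
    simp only [Function.comp_apply, y40_eq, ofComplex_apply_of_im_pos hz]
  rw [hfun.deriv_eq]
  have h4 := hasDerivAt_eulerFn_comp 4 τ
  have h10 := hasDerivAt_eulerFn_comp 10 τ
  have h20 := hasDerivAt_eulerFn_comp 20 τ
  have hqd : HasDerivAt (Function.Periodic.qParam 1) (2 * π * I * Function.Periodic.qParam 1 (τ : ℂ)) τ := by
    simpa using hasDerivAt_qParam 1 (τ : ℂ)
  have hden : Function.Periodic.qParam 1 (τ : ℂ) ^ 3 * (eulerFn 20 ∘ ofComplex) τ ^ 6 ≠ 0 := by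
    simp only [Function.comp_apply, ofComplex_apply]
    exact mul_ne_zero (pow_ne_zero _ hq) (pow_ne_zero _ hE20)
  have hD := ((h4.fun_pow 2).fun_mul (h10.fun_pow 4)).fun_div ((hqd.fun_pow 3).fun_mul (h20.fun_pow 6)) hden
  rw [hD.deriv]
  simp only [Function.comp_apply, ofComplex_apply]
  field_simp
  ring

end Summit.BirchSwinnertonDyer.BirchSwinnertonDyer.Theorems.ManinLocalTwoThree.EulerRemaindersForty

end
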